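import Summits.ValiantsHypothesis.ValiantsHypothesis.Theorems.BarrierLeverDefinableDcEquationsTopFormSingular
import Summits.ValiantsHypothesis.ValiantsHypothesis.Theorems.BarrierLeverDefinableDcEquationsConstantExcess

/-!
# Route BarrierLever — algebraic natural proofs against `dc ≤ n + k` on a LINEAR window `2k + 7`,
# and against `dc ≤ n + Θ(c·n / log n)` at level `14c + 11` (crux `DefinableDcEquations`, 8746)

The `dc`-axis rung of the rank-4 crux `DefinableDcEquations` in its Kumar–Volk form (the "`dc`
twin" of item 20156's natural proofs against all linear circuit sizes).  The tree's
`BarrierLeverDefinableDcEquationsConstantExcess.lean` certifies `{deg f ≤ n, dc f ≤ n + k}` with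
the Macaulay certificate `certPoly n w` on a window `w = (k+2)² + 1` (Eagon–Northcott for corank
`k + 2`); `BarrierLeverDefinableDcEquationsTopFormSingular.lean` (Kumar–Volk degree trading,
arbitrary `f`) shows that a window `w ≥ 2k + 7` already forces a singular top-form cone.  Hence:

* `eval_certPoly_eq_zero_of_dc_le_add_linear` — for `w ≥ 2k + 7`, `n ≥ 3`, `deg f ≤ n`,
  `dc f ≤ n + k`: `certPoly n w` vanishes at `coeff f`;
* `isNaturalProof_certPoly_of_dc_le_add_linear`, `not_isSuccinctHittingSet_dc_le_add_linear`
  (level `14(2k+7) + 11 = 28k + 109`, LINEAR in `k`; the `∃ a n₀` forms are the tree's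
  `naturalProofsAgainstDcPlusConst` / `dcEquations_of_threshold_le_add_const`, now with this
  better witness available);
* **level form** `naturalProofsAgainstDcLinearWindow`: for every `c`, ONE level `a = 14c + 11`
  such that for all `n ≥ 2^c` and ALL `k` with `(2k + 7)(log₂ n + 1) ≤ c·n` — excess
  `k = Θ(c·n / log n)` — `{deg ≤ n, dc ≤ n + k}` is not a succinct hitting set for
  `Distinguishers ℂ n a`; and `dcEquations_of_threshold_linear_window`: the equation clause of
  `DefinableDcEquations` for every threshold `m` with `(2(m n - n) + 7)(log₂ n + 1) ≤ c·n`
  eventually, i.e. `m(n) ≤ n + Θ(c·n / log n)`.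

Honest framing: thresholds `n(1 + Θ(c / log n))` — still `(1 + o(1))·n`, below the regime of the
known explicit lower bound `1.5n - 3` (Kumar–Volk); the content is FSV-constructivity
(`poly(N)`-size, `q = 0` boolean variables).  The crux's `2^(C log² n)` is untouched.  Nothing here
bears on `VP` vs `VNP`.  No definitions, no named-fact hypotheses; standard axioms.

References: M. Kumar, B. L. Volk, comput. complexity 31 (2022) 12, §3 [KumarVolk2022b]; M. Forbes,
A. Shpilka, B. L. Volk, Theory of Computing 14 (2018), Def. 1.1 / Thm. 4 [ForbesShpilkaVolk2018];
D. Cox, J. Little, D. O'Shea, *Using Algebraic Geometry*, Ch. 3 §4 [CoxLittleOSheaUsing2005].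
-/

-- layout Summits/ValiantsHypothesis/ValiantsHypothesis forces the duplicated namespace component
set_option linter.dupNamespace false

noncomputable section

open MvPolynomial Finset Matrix

namespace Summit.ValiantsHypothesis.ValiantsHypothesis.Theorems.BarrierLever.DcConstantExcess

open Literature.Computability.AlgebraicComplexity
open Literature.RingTheory.MvPolynomial.Macaulay
open Literature.Barriers.ValiantsHypothesis
open Summit.ValiantsHypothesis.ValiantsHypothesis.Theorems.BarrierLever.NaturalProofsAgainstAllLinearSizes
open Summit.ValiantsHypothesis.ValiantsHypothesis.Theorems.BarrierLever.DcEqualsDegree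

/-! ## §1 The certificate vanishes on `{deg f ≤ n, dc f ≤ n + k}` for every window `w ≥ 2k + 7` -/

/-- **The Macaulay certificate on a linear window vanishes on determinantal expressions of size
`n + k`.**  For `w ≥ 2k + 7`, `n ≥ 3` and every `f ∈ ℂ[x₁..xₙ]` with `deg f ≤ n`, `dc f ≤ n + k`:
`certPoly n w` (item 20156's distinguisher) vanishes at `coeff f` — restrict an affine
representation of size `n + k` to the first `w` coordinates, take a nonzero common zero of the
gradient of the top form (`exists_ne_zero_grad_topForm_det_eq_zero`), and kill the Macaulay
determinant (`Macaulay.det_macaulay_grad_eq_zero`). [cite: KumarVolk2022b, §3] -/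
theorem eval_certPoly_eq_zero_of_dc_le_add_linear {n k w : ℕ} (hw : 2 * k + 7 ≤ w) (hn : 3 ≤ n)
    (f : MvPolynomial (Fin n) ℂ) (hdeg : f.totalDegree ≤ n)
    (hdc : determinantalComplexity f ≤ n + k) :
    eval (coeffVector (degLEMonomials n) f) (certPoly n w) = 0 := by
  classical
  obtain ⟨M, hM1, hMdet⟩ := (hasDetRepr_iff_determinantalComplexity_le_holds f (n + k)).2 hdc
  let ρ : MvPolynomial (Fin n) ℂ →ₐ[ℂ] MvPolynomial (Fin w) ℂ := aeval (restr ℂ n w)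
  have hM'1 : ∀ i j, ((ρ.mapMatrix M) i j).totalDegree ≤ 1 := fun i j =>
    (totalDegree_aeval_restr_le (M i j)).trans (hM1 i j)
  have hdet' : (ρ.mapMatrix M).det = ρ f := by
    rw [← AlgHom.map_det, hMdet]
  have hdeg' : (ρ.mapMatrix M).det.totalDegree ≤ n := by
    rw [hdet']
    exact (totalDegree_aeval_restr_le f).trans hdeg
  obtain ⟨ζ, hζ, hgrad⟩ :=
    exists_ne_zero_grad_topForm_det_eq_zero rfl hn hw (ρ.mapMatrix M) hM'1 hdeg'
  rw [eval_certPoly w f hdeg]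
  refine det_macaulay_grad_eq_zero _ (homogeneousComponent_isHomogeneous n _) ζ hζ fun i => ?_
  show eval ζ (pderiv i (homogeneousComponent n (ρ f))) = 0
  rw [← hdet']
  exact hgrad i

/-! ## §2 Natural proofs against `dc ≤ n + k` at level linear in `k` -/

/-- **An algebraic natural proof against `dc ≤ n + k` on a linear window** (FSV Def. 1): for every
`w ≥ 2k + 7` and `n ≥ w`, `certPoly n w` is a nonzero level-`(14w + 11)` distinguisher vanishing on
`{f : deg f ≤ n, dc f ≤ n + k}`. [cite: KumarVolk2022b, §3] -/
theorem isNaturalProof_certPoly_of_dc_le_add_linear {n k w : ℕ} (hw : 2 * k + 7 ≤ w) (hwn : w ≤ n) :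
    IsNaturalProof (degLEMonomials n)
      {f : MvPolynomial (Fin n) ℂ | f.totalDegree ≤ n ∧ determinantalComplexity f ≤ n + k}
      (Distinguishers ℂ n (14 * w + 11)) (certPoly n w) :=
  ⟨certPoly_mem_distinguishers_window (by omega) hwn (by omega), certPoly_ne_zero (by omega) hwn,
    fun f hf => eval_certPoly_eq_zero_of_dc_le_add_linear hw (by omega) f hf.1 hf.2⟩

/-- **Hitting-set reading**: for `w ≥ 2k + 7` and `n ≥ w`, the degree-`≤ n` polynomials of
determinantal complexity `≤ n + k` are NOT a succinct hitting set for `Distinguishers ℂ n (14w + 11)`.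
[cite: ForbesShpilkaVolk2018, Thm. 4] -/
theorem not_isSuccinctHittingSet_dc_le_add_linear {n k w : ℕ} (hw : 2 * k + 7 ≤ w) (hwn : w ≤ n) :
    ¬ IsSuccinctHittingSet (degLEMonomials n)
      {f : MvPolynomial (Fin n) ℂ | f.totalDegree ≤ n ∧ determinantalComplexity f ≤ n + k}
      (Distinguishers ℂ n (14 * w + 11)) := by
  rw [← exists_isNaturalProof_iff]
  exact ⟨certPoly n w, isNaturalProof_certPoly_of_dc_le_add_linear hw hwn⟩

/-! ## §3 Level form: ONE level `14c + 11` against `dc ≤ n + k` for all `(2k + 7)(log₂ n + 1) ≤ c·n` -/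

/-- **Natural proofs against `dc ≤ n + Θ(c·n / log n)`, level form** (the `dc` twin of item
20156's `NaturalProofsAgainstAllLinearSizes`): for every `c` there is ONE level `a = 14c + 11` such
that for all `n ≥ 2^c` and EVERY `k` with `(2k + 7)(log₂ n + 1) ≤ c·n` the slice
`{deg f ≤ n, dc f ≤ n + k}` is not a succinct hitting set for `Distinguishers ℂ n a` (witness
`certPoly n (2k + 7)`, of size `n^{O(k)} ≤ N^{O(c)}`). [cite: KumarVolk2022b, §3] -/
theorem naturalProofsAgainstDcLinearWindow (c : ℕ) :
    ∃ a n₀ : ℕ, ∀ n ≥ n₀, ∀ k : ℕ, (2 * k + 7) * (Nat.log 2 n + 1) ≤ c * n →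
      ¬ IsSuccinctHittingSet (degLEMonomials n)
        {f : MvPolynomial (Fin n) ℂ | f.totalDegree ≤ n ∧ determinantalComplexity f ≤ n + k}
        (Distinguishers ℂ n a) := by
  refine ⟨14 * c + 11, 2 ^ c, fun n hn k hk => ?_⟩
  have hwn : 2 * k + 7 ≤ n := window_le hn (by omega) hk
  rw [← exists_isNaturalProof_iff]
  exact ⟨certPoly n (2 * k + 7), certPoly_mem_distinguishers_of_window (by omega) (by omega) hwn hk,
    certPoly_ne_zero (by omega) hwn,
    fun f hf => eval_certPoly_eq_zero_of_dc_le_add_linear le_rfl (by omega) f hf.1 hf.2⟩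

/-- **The equation clause of `DefinableDcEquations` for every threshold
`m(n) ≤ n + Θ(c·n / log n)`:** for every `c` and every threshold function `m` with
`(2(m n - n) + 7)(log₂ n + 1) ≤ c·n` eventually, the inner statement of
`BarrierLever.DefinableDcEquations` holds at level `a = 14c + 11` (`q = 0`,
`H = certPoly n (2(m n - n) + 7)`).  This is the full range of thresholds the singular-locus
method certifies with `poly(N)`-size equations; the crux's own `2^(C (log₂ n + 1)²)` is
untouched. [cite: KumarVolk2022b, §3] -/
theorem dcEquations_of_threshold_linear_window (c : ℕ) (m : ℕ → ℕ) {n₁ : ℕ}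
    (hm : ∀ n, n₁ ≤ n → (2 * (m n - n) + 7) * (Nat.log 2 n + 1) ≤ c * n) :
    ∃ a n₀ : ℕ, ∀ n ≥ n₀, ∃ q : ℕ, q ≤ (Nat.choose (2 * n) n) ^ a ∧
      ∃ H : MvPolynomial (↥(degLEMonomials n) ⊕ Fin q) ℂ,
        complexity H ≤ (Nat.choose (2 * n) n) ^ a ∧ H.totalDegree ≤ (Nat.choose (2 * n) n) ^ a ∧
        boolSum H ≠ 0 ∧
        ∀ f : MvPolynomial (Fin n) ℂ, f.totalDegree ≤ n → determinantalComplexity f ≤ m n →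
          eval (coeffVector (degLEMonomials n) f) (boolSum H) = 0 := by
  refine ⟨14 * c + 11, max n₁ (2 ^ c), fun n hn => ?_⟩
  have hk := hm n ((le_max_left _ _).trans hn)
  have hwn : 2 * (m n - n) + 7 ≤ n := window_le ((le_max_right _ _).trans hn) (by omega) hk
  refine ⟨0, Nat.zero_le _, rename Sum.inl (certPoly n (2 * (m n - n) + 7)), ?_, ?_, ?_, ?_⟩
  · exact (complexity_rename_le_holds' _ _).trans
      (certPoly_mem_distinguishers_of_window (by omega) (by omega) hwn hk).1
  · exact (totalDegree_rename_le _ _).trans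
      (certPoly_mem_distinguishers_of_window (by omega) (by omega) hwn hk).2
  · rw [boolSum_rename_inl_zero]
    exact certPoly_ne_zero (by omega) hwn
  · intro f hdeg hdc
    rw [boolSum_rename_inl_zero]
    exact eval_certPoly_eq_zero_of_dc_le_add_linear le_rfl (by omega) f hdeg (hdc.trans le_add_tsub)

end Summit.ValiantsHypothesis.ValiantsHypothesis.Theorems.BarrierLever.DcConstantExcess

end
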